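import Summits.BirchSwinnertonDyer.BirchSwinnertonDyer.Theorems.ErratumRoadFiveNonSurjCornerKolyJLevelTransport
import Summits.BirchSwinnertonDyer.BirchSwinnertonDyer.Theorems.ErratumRoadFiveNonSurjCornerKolyJLevelOneAvatar
import Summits.BirchSwinnertonDyer.BirchSwinnertonDyer.Theorems.ErratumRoadFiveShimuraKolyvaginOrderBoundInertCarrierEuler
import Summits.BirchSwinnertonDyer.BirchSwinnertonDyer.Theorems.Rank1ResidualJetSection6
import HarnessLib

/-!
# T1 JET (cell `bsd-jet`), road K — the LEVEL LINK between the root class `κ̃` at level `p^k` and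
# the Kolyvagin class `c_{k+s}(P)` at level `p^{k+s}`, read at a place where `E[p^{k+s}]` is trivial

HONEST FRAMING (programme file §HONESTY, verbatim): «no tranche here proves BSD; ARM L moves the
LITERAL column of an r ≤ 1 census into the kernel-proved-modulo-named-print column.» THEOREMS ONLY
(seat `bsd-jet-pv-1`, session g8; `--supports stmt-BirchSwinnertonDyer-14418`, helper); 0 classes move.

WHAT THIS FILE DOES. One lemma of pure bookkeeping for the TWO-LEVEL core-vertex walk (Jetchev 2008
Prop. 5.3 = arXiv Prop. 6.4 read with [J] Lemma 3.4 at the level `k + s`): for a Kolyvagin–Heegner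
datum `d` of conductor `n`, a `p^u`-th root `Q` of `P = d.derivedPoint` (`u ≤ s`), with `E(K[n]) ⊆ E(K̄)`
admissible and `[Q]`, `[P]` invariant at the two levels, the change of level
`ι_* : H¹(K, E[p^k]) → H¹(K, E[p^{k+s}])` sends the root class `κ̃ = c_k(Q)` to
`c_{k+s}(p^{s-u} P) = p^{s-u} · c_{k+s}(P)` (`Koly.torsionH1OfDvd_kolyvaginClass_of_zsmul`, x11b3 ∕ stepL;
`Theorems.kolyvaginClass_zsmul_add_zsmul_eq`, shim), and at a place `v` whose decomposition group fixes
`E[p^{k+s}]` (a Kolyvagin prime of index `≥ k + s`, [G] Prop. 9.6 ∕ [McC] §3 (3)) `ι_*` preserves the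
order of localisations (`Theorems.localization_eq_zero_iff_torsionH1OfDvd`). Hence
`ord loc_v κ̃ = p^k ⟹ ord loc_v c_{k+s}(P) = p^{k+s-u}` (`k ≥ 1`; the local class is killed by `p^{k+s}`).
References: [cite: Jetchev2008, §3.1 item 7 (p. 817), Lemma 3.4, proof of Prop. 5.3 (pp. 823–824)]
[cite: McCallumLMS1991, §3 (3), §4 (4)–(6), Lemma 4.6] [cite: GrossLMS1991, §4 (4.2)–(4.6), Prop. 9.6].
Design: one theorem, no definitions; `K : Type`. Axioms: `propext`, `Classical.choice`, `Quot.sound`.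
-/

set_option autoImplicit false

noncomputable section

open scoped Classical NumberField

namespace Summit.BirchSwinnertonDyer.Rank1Residual.JET

open WeierstrassCurve IsDedekindDomain NumberField Field Literature.NumberTheory.EllipticCurves
  Literature.NumberTheory.EllipticCurves.ModularForms Literature.NumberTheory.EllipticCurves.KolyvaginCocycle
  Literature.NumberTheory.GaloisRepresentations Literature.NumberTheory.GaloisCohomology
  Literature.NumberTheory.GaloisRepresentations.DiscreteGaloisModule
  Summit.BirchSwinnertonDyer.Rank1Residual.X11b Summit.BirchSwinnertonDyer.Rank1Residual.X11b.Three

/-- **The level link for the root class** ([J] §3.1 item 7 with Lemma 3.4 at level `k + s`): if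
`p^u Q = P = d.derivedPoint` (`u ≤ s`, `k ≥ 1`), `E(K[n]) ⊆ E(K̄)` is admissible and `[Q]`, `[P]` are
invariant mod `p^k`, `p^{k+s}`, and `Γ_{K_v}` fixes `E[p^{k+s}]`, then
`ord loc_v c_k(Q) = p^k ⟹ ord loc_v c_{k+s}(P) = p^{k+s-u}` — because `ι_* c_k(Q) = p^{s-u} · c_{k+s}(P)`
and `ι_*` preserves local orders at `v`. [cite: Jetchev2008, §3.1 item 7, Lemma 3.4]
[cite: McCallumLMS1991, §3 (3), §4 (4)–(6)] [cite: GrossLMS1991, Prop. 9.6] -/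
theorem addOrderOf_localization_kolyvaginClass_of_rootClass
    {K : Type} [Field K] [NumberField K] {N : ℕ} [NeZero N] {W : WeierstrassCurve ℚ} [W.IsElliptic]
    {Dt : ModularParametrizationData W N} {β : ℤ} {ι : K →+* ℂ} {n : ℕ}
    (d : KolyvaginHeegnerData Dt β ι n) {p : ℕ} (hp : p.Prime) {k s u : ℕ} (hk : 1 ≤ k) (hus : u ≤ s)
    (hAk : IsAdmissible (absoluteGaloisGroup K) d.pointsSubgroup ((p ^ k : ℕ) : ℤ))
    (hAks : IsAdmissible (absoluteGaloisGroup K) d.pointsSubgroup ((p ^ (k + s) : ℕ) : ℤ))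
    {Q : (W.baseChange (ringClassField K ι n)).toAffine.Point}
    (hQ : d.toGeomPoints Q ∈ invPoints (absoluteGaloisGroup K) d.pointsSubgroup ((p ^ k : ℕ) : ℤ))
    (hQP : ((p ^ u : ℕ) : ℤ) • Q = d.derivedPoint)
    (hP : d.toGeomPoints d.derivedPoint ∈
      invPoints (absoluteGaloisGroup K) d.pointsSubgroup ((p ^ (k + s) : ℕ) : ℤ))
    (v : HeightOneSpectrum (𝓞 K))
    (htriv : ∀ (g : absoluteGaloisGroup (v.adicCompletion K))
      (T : geomTorsion (W.baseChange K) ((p ^ (k + s) : ℕ) : ℤ)), resGal (K := K) (v.adicCompletion K) g • T = T)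
    (hord : addOrderOf (galoisCohomology.localization
      ((W.baseChange K).torsionGaloisModule ((p ^ k : ℕ) : ℤ)) (Sum.inr v : Place K) 1
      (kolyvaginClass (W.baseChange K) ((p ^ k : ℕ) : ℤ)
        ((W.baseChange K).zsmul_geomPoints_surjective_of_charZero
          (by exact_mod_cast pow_ne_zero k hp.ne_zero)) hAk (d.toGeomPoints Q) hQ)) = p ^ k) :
    addOrderOf (galoisCohomology.localization
      ((W.baseChange K).torsionGaloisModule ((p ^ (k + s) : ℕ) : ℤ)) (Sum.inr v : Place K) 1
      (d.kolyvaginClass hp (k + s))) = p ^ (k + s - u) := by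
  -- `p^k ∣ p^{k+s}`, `p^{k+s} = p^s · p^k`, `p^{s-u} · p^u = p^s`
  have hdvdN : p ^ k ∣ p ^ (k + s) := pow_dvd_pow p (Nat.le_add_right k s)
  have hdvdZ : ((p ^ k : ℕ) : ℤ) ∣ ((p ^ (k + s) : ℕ) : ℤ) := Int.natCast_dvd_natCast.mpr hdvdN
  have hnm : ((p ^ (k + s) : ℕ) : ℤ) = ((p ^ s : ℕ) : ℤ) * ((p ^ k : ℕ) : ℤ) := by
    push_cast; ring
  have hps : ((p ^ (s - u) : ℕ) : ℤ) * ((p ^ u : ℕ) : ℤ) = ((p ^ s : ℕ) : ℤ) := by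
    rw [← Nat.cast_mul, ← pow_add, Nat.sub_add_cancel hus]
  -- `p^s · Q̃ = p^{s-u} · P + p^{k+s} · 0` in `E(K̄)`, an invariant point mod `p^{k+s}`
  have hTQ : ((p ^ u : ℕ) : ℤ) • d.toGeomPoints Q = d.toGeomPoints d.derivedPoint := by
    rw [← map_zsmul]; exact congrArg _ hQP
  have hPQ : ((p ^ s : ℕ) : ℤ) • d.toGeomPoints Q =
      ((p ^ (s - u) : ℕ) : ℤ) • d.toGeomPoints d.derivedPoint +
        ((p ^ (k + s) : ℕ) : ℤ) • (0 : geomPoints (W.baseChange K)) := by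
    rw [smul_zero, add_zero, ← hTQ, smul_smul, hps]
  have hP' : ((p ^ (s - u) : ℕ) : ℤ) • d.toGeomPoints d.derivedPoint +
        ((p ^ (k + s) : ℕ) : ℤ) • (0 : geomPoints (W.baseChange K)) ∈
      invPoints (absoluteGaloisGroup K) d.pointsSubgroup ((p ^ (k + s) : ℕ) : ℤ) := by
    rw [smul_zero, add_zero]; exact (invPoints _ _ _).zsmul_mem hP _
  -- `ι_* c_k(Q̃) = c_{k+s}(p^{s-u} P + p^{k+s}·0) = p^{s-u} · c_{k+s}(P) = p^{s-u} · d.c_{k+s}`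
  have hι := Koly.torsionH1OfDvd_kolyvaginClass_of_zsmul (W.baseChange K) hdvdZ hnm
    ((W.baseChange K).zsmul_geomPoints_surjective_of_charZero
      (by exact_mod_cast pow_ne_zero k hp.ne_zero))
    ((W.baseChange K).zsmul_geomPoints_surjective_of_charZero
      (by exact_mod_cast pow_ne_zero (k + s) hp.ne_zero))
    hAk hAks hQ hPQ hP'
  have hlin := Summit.BirchSwinnertonDyer.BirchSwinnertonDyer.Theorems.kolyvaginClass_zsmul_add_zsmul_eq
    (hdiv := (W.baseChange K).zsmul_geomPoints_surjective_of_charZero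
      (by exact_mod_cast pow_ne_zero (k + s) hp.ne_zero))
    hAks hP ((p ^ (s - u) : ℕ) : ℤ) (d.pointsSubgroup.zero_mem) hP'
  have hκ₂ := (d.kolyvaginClass_of_admissible hp (k + s) hAks hP).symm
  rw [hlin, hκ₂] at hι
  -- abbreviations: the two localisation maps at `v` and the root class `κ̃ = c_k(Q̃)`
  set L₁ := galoisCohomology.localization ((W.baseChange K).torsionGaloisModule ((p ^ k : ℕ) : ℤ))
    (Sum.inr v : Place K) 1 with hL₁
  set L₂ := galoisCohomology.localization
    ((W.baseChange K).torsionGaloisModule ((p ^ (k + s) : ℕ) : ℤ)) (Sum.inr v : Place K) 1 with hL₂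
  set x := kolyvaginClass (W.baseChange K) ((p ^ k : ℕ) : ℤ)
    ((W.baseChange K).zsmul_geomPoints_surjective_of_charZero
      (by exact_mod_cast pow_ne_zero k hp.ne_zero)) hAk (d.toGeomPoints Q) hQ with hx
  -- `ι_*` preserves the local order at `v` (the types `galH1Torsion` ∕ `galoisCohomology … 1` agree
  -- definitionally but not reducibly: every `•` crosses `ι_*` and `loc` by `exact`, never by `rw`)
  have hordι : addOrderOf (L₂ (torsionH1OfDvd (W.baseChange K) hdvdZ x)) = p ^ k := by
    refine Eq.trans ?_ hord
    refine addOrderOf_eq_addOrderOf_iff.mpr (fun j ↦ ?_)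
    have e1 : j • L₂ (torsionH1OfDvd (W.baseChange K) hdvdZ x) =
        L₂ (torsionH1OfDvd (W.baseChange K) hdvdZ (j • x)) := by
      rw [map_nsmul (torsionH1OfDvd (W.baseChange K) hdvdZ)]
      exact (map_nsmul _ _ _).symm
    have e2 : j • L₁ x = L₁ (j • x) := (map_nsmul _ _ _).symm
    rw [e1, e2]
    exact (Summit.BirchSwinnertonDyer.BirchSwinnertonDyer.Theorems.localization_eq_zero_iff_torsionH1OfDvd
      W hdvdN (pow_ne_zero k hp.ne_zero) (pow_ne_zero (k + s) hp.ne_zero) v htriv _).symm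
  rw [hι] at hordι
  have e3 : L₂ (((p ^ (s - u) : ℕ) : ℤ) • d.kolyvaginClass hp (k + s)) =
      (p ^ (s - u)) • L₂ (d.kolyvaginClass hp (k + s)) := by
    rw [← natCast_zsmul]
    exact map_zsmul _ _ _
  rw [e3] at hordι
  -- arithmetic: `z := loc_v c_{k+s}(P)` is killed by `p^{k+s}` and `p^{s-u} z` has order `p^k ≠ 1`
  generalize hz : L₂ (d.kolyvaginClass hp (k + s)) = z at hordι ⊢
  have hkill : p ^ (k + s) • z = 0 :=
    galoisCohomology.nsmul_eq_zero_of_forall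
      (((W.baseChange K).torsionGaloisModule ((p ^ (k + s) : ℕ) : ℤ)).toLocal (Sum.inr v : Place K))
      (fun T ↦ by
        have h := (W.baseChange K).natAbs_nsmul_geomTorsion T
        rwa [Int.natAbs_natCast] at h) z
  obtain ⟨e, -, he⟩ := (Nat.dvd_prime_pow hp).mp (addOrderOf_dvd_of_nsmul_eq_zero hkill)
  rcases Nat.lt_or_ge e (s - u) with hlt | hle
  · exfalso
    have h0 : p ^ (s - u) • z = 0 := by
      rw [← addOrderOf_dvd_iff_nsmul_eq_zero, he]
      exact pow_dvd_pow p hlt.le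
    rw [h0, addOrderOf_zero] at hordι
    exact (Nat.one_lt_pow (by omega) hp.one_lt).ne hordι
  · rw [Section6.addOrderOf_pow_nsmul_eq hp hle z he] at hordι
    have hek : e - (s - u) = k := Nat.pow_right_injective hp.two_le hordι
    rw [he]
    congr 1
    omega

end Summit.BirchSwinnertonDyer.Rank1Residual.JET

end
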